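import Literature.Topology.FourManifolds.InverseFunctionTheorem
import Mathlib.Analysis.Calculus.BumpFunction.InnerProduct
import HarnessLib

/-!
# The level suspension of an ambient isotopy of `P`: an ambient isotopy of `ℝ × P` preserving
# the slices `{s} × P`, running the given isotopy at full speed on the slice `s = 0` and not
# at all on the slices `|s| ≥ ε`

Topic `Literature/Topology/FourManifolds`.  In the proof of Thm. 5.4, Assertion 6 (Milnor,
*Lectures on the h-cobordism theorem* (1965), PDF pp. 31–32) an isotopy of the level `f⁻¹(b₂)`
near `p₂` is given in level coordinates `Rᵃ × Rᵇ`; to transport it into the cobordism with the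
tree's chart transport (`AmbientIsotopyTransport.lean`, `AmbientIsotopy.chartTransport`, which
wants an isotopy of the full model of the chart, here `ℝ × (Rᵃ × Rᵇ)` with first coordinate
`f - b₂`, supported in a ball) one first suspends it across the neighbouring levels, damping the
time parameter by a bump function of the level: `Ĝ_t(s, y) = (s, G_{χ(s)t}(y))`.  This file
records that construction (`AmbientIsotopy.levelSuspension`) and its bookkeeping: every stage
preserves the first coordinate, is `(s, y) ↦ (s, G_t y)` on the slice `s = 0` when `χ 0 = 1`, is
the identity on the slices where `χ` vanishes and off `B̄(0, R)` in `P` when `G` is, hence is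
supported in the closed ball of radius `max ε R` of `ℝ × P` (sup norm).  Everything is proved;
no named facts.

## References

* M. W. Hirsch, *Differential Topology*, GTM 33 (1976), Ch. 8 §1, pp. 178–180 (isotopies,
  ambient isotopies, supports). [HirschDT1976]
* J. Milnor, *Lectures on the h-cobordism theorem* (1965), proof of Thm. 5.4, Assertion 6
  (PDF pp. 31–32). [MilnorHCobordism1965]
-/

open scoped Manifold ContDiff Topology
open Set Function Filter Metric

noncomputable section

namespace Literature.Topology.FourManifolds

namespace AmbientIsotopy

variable {P : Type*} [NormedAddCommGroup P] [NormedSpace ℝ P] [CompleteSpace P]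

omit [CompleteSpace P] in
/-- The stages of an ambient isotopy of a normed space are jointly smooth in the vector-space
sense. [folklore] -/
theorem contDiff_uncurry_toFun (G : AmbientIsotopy 𝓘(ℝ, P) P) : ContDiff ℝ ∞ (uncurry G.toFun) := by
  have h := G.contMDiff
  rw [← modelWithCornersSelf_prod, chartedSpaceSelf_prod] at h
  exact contMDiff_iff_contDiff.1 h

/-- The inverse stages of an ambient isotopy of a normed space are jointly smooth in the
vector-space sense. [folklore] -/
theorem contDiff_uncurry_invFun (G : AmbientIsotopy 𝓘(ℝ, P) P) :
    ContDiff ℝ ∞ (uncurry G.toDiffeotopy.invFun) := by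
  have h := G.toDiffeotopy.contMDiff_uncurry_invFun
  rw [← modelWithCornersSelf_prod, chartedSpaceSelf_prod] at h
  exact contMDiff_iff_contDiff.1 h

/-- The stage family of the level suspension: `(s, y) ↦ (s, G_{χ(s)t}(y))`. [folklore] -/
def levelSuspensionFun (G : AmbientIsotopy 𝓘(ℝ, P) P) (χ : ℝ → ℝ) (t : ℝ) (q : ℝ × P) : ℝ × P :=
  (q.1, G.toFun (χ q.1 * t) q.2)

/-- The inverse stage family of the level suspension. [folklore] -/
def levelSuspensionInv (G : AmbientIsotopy 𝓘(ℝ, P) P) (χ : ℝ → ℝ) (t : ℝ) (q : ℝ × P) : ℝ × P :=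
  (q.1, G.toDiffeotopy.invFun (χ q.1 * t) q.2)

variable (G : AmbientIsotopy 𝓘(ℝ, P) P) {χ : ℝ → ℝ} (hχ : ContDiff ℝ ∞ χ)

omit [CompleteSpace P] in
/-- Unfolding the stage family. [folklore] -/
@[simp] theorem levelSuspensionFun_apply (χ : ℝ → ℝ) (t : ℝ) (q : ℝ × P) :
    G.levelSuspensionFun χ t q = (q.1, G.toFun (χ q.1 * t) q.2) := rfl

omit [CompleteSpace P] in
include hχ in
/-- The stage family is jointly smooth in `(t, s, y)`. [folklore] -/
theorem contDiff_uncurry_levelSuspensionFun :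
    ContDiff ℝ ∞ (uncurry (G.levelSuspensionFun χ)) := by
  have hG := G.contDiff_uncurry_toFun
  have h1 : ContDiff ℝ ∞ fun p : ℝ × (ℝ × P) => (χ p.2.1 * p.1, p.2.2) :=
    ((hχ.comp (contDiff_fst.comp contDiff_snd)).mul contDiff_fst).prodMk
      (contDiff_snd.comp contDiff_snd)
  exact (contDiff_fst.comp contDiff_snd).prodMk (hG.comp h1)

include hχ in
/-- The inverse stage family is jointly smooth in `(t, s, y)`. [folklore] -/
theorem contDiff_uncurry_levelSuspensionInv :
    ContDiff ℝ ∞ (uncurry (G.levelSuspensionInv χ)) := by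
  have hG := G.contDiff_uncurry_invFun
  have h1 : ContDiff ℝ ∞ fun p : ℝ × (ℝ × P) => (χ p.2.1 * p.1, p.2.2) :=
    ((hχ.comp (contDiff_fst.comp contDiff_snd)).mul contDiff_fst).prodMk
      (contDiff_snd.comp contDiff_snd)
  exact (contDiff_fst.comp contDiff_snd).prodMk (hG.comp h1)

omit [CompleteSpace P] in
include hχ in
/-- Each stage is smooth. [folklore] -/
theorem contDiff_levelSuspensionFun (t : ℝ) : ContDiff ℝ ∞ (G.levelSuspensionFun χ t) :=
  (G.contDiff_uncurry_levelSuspensionFun hχ).comp (contDiff_const.prodMk contDiff_id)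

include hχ in
/-- Each inverse stage is smooth. [folklore] -/
theorem contDiff_levelSuspensionInv (t : ℝ) : ContDiff ℝ ∞ (G.levelSuspensionInv χ t) :=
  (G.contDiff_uncurry_levelSuspensionInv hχ).comp (contDiff_const.prodMk contDiff_id)

/-- The inverse stage undoes the stage. [folklore] -/
theorem levelSuspensionInv_levelSuspensionFun (χ : ℝ → ℝ) (t : ℝ) (q : ℝ × P) :
    G.levelSuspensionInv χ t (G.levelSuspensionFun χ t q) = q := by
  obtain ⟨s, y⟩ := q
  simp only [levelSuspensionInv, levelSuspensionFun_apply]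
  refine Prod.ext rfl ?_
  have := G.toDiffeotopy.invFun_toFun (χ s * t) y
  rwa [G.toDiffeotopy_toFun] at this

/-- The stage undoes the inverse stage. [folklore] -/
theorem levelSuspensionFun_levelSuspensionInv (χ : ℝ → ℝ) (t : ℝ) (q : ℝ × P) :
    G.levelSuspensionFun χ t (G.levelSuspensionInv χ t q) = q := by
  obtain ⟨s, y⟩ := q
  simp only [levelSuspensionInv, levelSuspensionFun_apply]
  refine Prod.ext rfl ?_
  have := G.toDiffeotopy.toFun_invFun (χ s * t) y
  rwa [G.toDiffeotopy_toFun] at this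

/-- **The stage of the level suspension as a diffeomorphism of `ℝ × P`.** [folklore] -/
def levelSuspensionStage (hχ : ContDiff ℝ ∞ χ) (t : ℝ) : (ℝ × P) ≃ₘ⟮𝓘(ℝ, ℝ × P), 𝓘(ℝ, ℝ × P)⟯ (ℝ × P) where
  toFun := G.levelSuspensionFun χ t
  invFun := G.levelSuspensionInv χ t
  left_inv := G.levelSuspensionInv_levelSuspensionFun χ t
  right_inv := G.levelSuspensionFun_levelSuspensionInv χ t
  contMDiff_toFun := (G.contDiff_levelSuspensionFun hχ t).contMDiff
  contMDiff_invFun := (G.contDiff_levelSuspensionInv hχ t).contMDiff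

/-- **The level suspension of an ambient isotopy of `P`**: the ambient isotopy
`Ĝ_t(s, y) = (s, G_{χ(s)t}(y))` of `ℝ × P`, for a smooth damping function `χ : ℝ → ℝ`.
[cite: HirschDT1976, Ch. 8 §1, p. 178] -/
def levelSuspension (hχ : ContDiff ℝ ∞ χ) : AmbientIsotopy 𝓘(ℝ, ℝ × P) (ℝ × P) where
  toFun := G.levelSuspensionFun χ
  contMDiff := by
    rw [← modelWithCornersSelf_prod, chartedSpaceSelf_prod]
    exact (G.contDiff_uncurry_levelSuspensionFun hχ).contMDiff
  bijective t := (G.levelSuspensionStage hχ t).bijective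
  isLocalDiffeomorph t := (G.levelSuspensionStage hχ t).isLocalDiffeomorph
  map_zero := by
    funext q
    simp [levelSuspensionFun, G.map_zero]

/-- Stages of the level suspension (definitional). [folklore] -/
@[simp]
theorem levelSuspension_toFun (t : ℝ) (q : ℝ × P) :
    (G.levelSuspension hχ).toFun t q = (q.1, G.toFun (χ q.1 * t) q.2) := rfl

/-- The level suspension preserves the slices `{s} × P`. [folklore] -/
theorem levelSuspension_toFun_fst (t : ℝ) (q : ℝ × P) : ((G.levelSuspension hχ).toFun t q).1 = q.1 :=
  rfl

/-- On the slice `s = 0` the level suspension is `G` itself, when `χ 0 = 1`. [folklore] -/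
theorem levelSuspension_toFun_zero (h0 : χ 0 = 1) (t : ℝ) (y : P) :
    (G.levelSuspension hχ).toFun t (0, y) = (0, G.toFun t y) := by
  simp [h0]

/-- On the slices where `χ` vanishes the level suspension is the identity. [folklore] -/
theorem levelSuspension_toFun_of_eq_zero {s : ℝ} (hs : χ s = 0) (t : ℝ) (y : P) :
    (G.levelSuspension hχ).toFun t (s, y) = (s, y) := by
  simp [hs, G.map_zero]

/-- Where `G` is stationary, so is the level suspension. [folklore] -/
theorem levelSuspension_toFun_of_forall_eq {y : P} (hy : ∀ τ, G.toFun τ y = y) (t s : ℝ) :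
    (G.levelSuspension hχ).toFun t (s, y) = (s, y) := by
  simp [hy]

/-- **Support of the level suspension**: if `χ` vanishes off `(-ε, ε)` and every stage of `G`
is the identity off `B̄(0, R)`, then every stage of the level suspension is the identity off the
closed ball of radius `max ε R` of `ℝ × P` (sup norm). [cite: HirschDT1976, Ch. 8 §1, p. 180] -/
theorem levelSuspension_toFun_eq_self {ε R : ℝ} (hε : ∀ s, ε ≤ |s| → χ s = 0)
    (hR : ∀ τ y, R ≤ ‖y‖ → G.toFun τ y = y) (t : ℝ) (q : ℝ × P) (hq : max ε R ≤ ‖q‖) :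
    (G.levelSuspension hχ).toFun t q = q := by
  obtain ⟨s, y⟩ := q
  rw [Prod.norm_mk, Real.norm_eq_abs] at hq
  rcases le_total |s| ‖y‖ with h | h
  · rw [max_eq_right h] at hq
    exact G.levelSuspension_toFun_of_forall_eq hχ (fun τ => hR τ y ((le_max_right _ _).trans hq)) t s
  · rw [max_eq_left h] at hq
    exact G.levelSuspension_toFun_of_eq_zero hχ (hε s ((le_max_left _ _).trans hq)) t y

/-- Fixed points of `G` on the slice `s = 0` are fixed by the level suspension. [folklore] -/
theorem levelSuspension_toFun_zero_of_eq (h0 : χ 0 = 1) {y : P} (t : ℝ) (hy : G.toFun t y = y) :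
    (G.levelSuspension hχ).toFun t (0, y) = (0, y) := by
  rw [G.levelSuspension_toFun_zero hχ h0, hy]

end AmbientIsotopy

/-! ### A damping function -/

/-- **A damping function**: for `ε > 0` there is a smooth `χ : ℝ → ℝ` with `χ 0 = 1`, vanishing
for `|s| ≥ ε`, with values in `[0, 1]` (a bump function on `ℝ`). [folklore] -/
theorem exists_damping {ε : ℝ} (hε : 0 < ε) :
    ∃ χ : ℝ → ℝ, ContDiff ℝ ∞ χ ∧ χ 0 = 1 ∧ (∀ s, ε ≤ |s| → χ s = 0) ∧ ∀ s, χ s ∈ Icc (0 : ℝ) 1 := by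
  let b : ContDiffBump (0 : ℝ) := ⟨ε / 2, ε, by linarith, by linarith⟩
  refine ⟨fun s => b s, b.contDiff, ?_, fun s hs => ?_, fun s => ⟨b.nonneg, b.le_one⟩⟩
  · exact b.one_of_mem_closedBall (mem_closedBall_self (by positivity))
  · apply b.zero_of_le_dist
    simpa [b, Real.dist_eq] using hs

end Literature.Topology.FourManifolds
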